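import Literature.InformationTheory.Coding.BCHExplicitFP
import HarnessLib

/-!
# Umans' generator, machine level I: the field `K = GF(2^{M+1})` on bitmask codes — algebraic
# bridges for the `GF(2)[X]` bricks

Literature / circuit complexity — derandomization. First file of the polynomial-time realisation
(U7 of the tree's proof of C. Umans, JCSS 2003, Thm. 6) of the reconstruction procedure and of the
generator. The base field `K = 𝔽_q`, `q = 2^{M+1}`, is the explicit `GF2 M = 𝔽₂[X]/(f_M)` of
`InformationTheory/Coding/BCHExplicit.lean`; its elements travel as the bitmasks `n < 2^{M+1}` of
their remainder polynomials (`GF2.elt M n`), and the arithmetic on bitmasks is that of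
`InformationTheory/Coding/GF2XArithFP.lean` (`xorW`, `GF2X.mulMod`, `GF2X.powMod`, each with its
`CodeFP` certificate in the modulus context `(1ᵂ, f, P)`). This file supplies the ALGEBRAIC
BRIDGES the later machine files consume:

* `UmansFP.toBits M u` — the canonical bitmask of `u : GF2 M` (`elt_toBits`, `toBits_elt`,
  `toBits_lt`, `toBits_injective`); the enumeration `kelems M = [0, …, 2^{M+1})` of the field;
* `UmansFP.kctx M = (M+2, canonIrredBits M, 2^{M+1})` — the modulus context of `GF2 M`;
* `UmansFP.elt_xor` (`elt (a ⊕ b) = elt a + elt b`), `UmansFP.kmul`/`kmul_spec`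
  (`elt (kmul a b) = elt a · elt b`, reduced), `UmansFP.kpow`/`kpow_spec` (`elt (kpow a e) = (elt a)^e`),
  `UmansFP.kpowB`/`kpowB_spec` (binary powering), `UmansFP.kinv`/`kinv_spec` (Fermat inverse `a^{q-2}`), the cardinality `card_GF2 : |GF2 M| = 2^{M+1}`
  and `pow_card_sub_one` (`u^{q-1} = 1` for `u ≠ 0`);
* the `CodeFP` forms `kmulFP`, `kpowFP`, `kpowBFP`, `kinvFP` on the context code `kctxE` (the bricks of
  `GF2XArithFP.lean` with `W` rounds; the powering loop by `CodeFP.foldl`).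

Everything is proved; no named fact.

## References

* C. Umans, *Pseudo-random generators for all hardnesses*, JCSS 67 (2003), §3 ("In computations, we
  assume that elements of `F_{q^d}` are represented as vectors …") [Umans2003].
* R. J. McEliece, *The Theory of Information and Coding*, 2nd ed., CUP 2002, Ch. 9 §9.1
  (`GF(2^m) = 𝔽₂[x]/(f)`) [Mceliece2002].
* D. E. Knuth, *The Art of Computer Programming*, Vol. 2, §4.6.3 [KnuthTAOCP2].
-/

noncomputable section

namespace Literature.Computability.Complexity

open Polynomial Literature.InformationTheory.Coding
open Literature.InformationTheory.Coding.GF2X CodeFP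

namespace UmansFP

variable (M : ℕ)

/-! ### Canonical bitmasks -/

/-- **The canonical bitmask of an element of `GF(2^{M+1})`**: the bits of its remainder polynomial
modulo `f_M`. [cite: Mceliece2002, Ch. 9 §9.1] -/
def toBits (u : GF2 M) : ℕ := polyBits (AdjoinRoot.modByMonicHom (monic_canonIrred M) u)

/-- `elt (toBits u) = u`. [folklore] -/
theorem elt_toBits (u : GF2 M) : GF2.elt M (toBits M u) = u := by
  rw [toBits, GF2.elt, bitsPoly_polyBits]
  exact AdjoinRoot.mk_leftInverse (monic_canonIrred M) u

/-- Canonical bitmasks are `< 2^{M+1}`. [folklore] -/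
theorem toBits_lt (u : GF2 M) : toBits M u < 2 ^ (M + 1) := by
  unfold toBits
  refine polyBits_lt_two_pow ?_
  obtain ⟨p, rfl⟩ := AdjoinRoot.mk_surjective u
  rw [AdjoinRoot.modByMonicHom_mk]
  have h := degree_modByMonic_lt p (monic_canonIrred M)
  rwa [degree_eq_natDegree (monic_canonIrred M).ne_zero, natDegree_canonIrred] at h

/-- `toBits (elt n) = n` for `n < 2^{M+1}`. [folklore] -/
theorem toBits_elt {n : ℕ} (hn : n < 2 ^ (M + 1)) : toBits M (GF2.elt M n) = n :=
  GF2.elt_injective (toBits_lt M _) hn (by rw [elt_toBits])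

/-- `toBits` is injective. [folklore] -/
theorem toBits_injective : Function.Injective (toBits M) := fun u v h => by
  rw [← elt_toBits M u, ← elt_toBits M v, h]

/-- **The enumeration of `GF(2^{M+1})`** by bitmasks: `[0, …, 2^{M+1})`. [folklore] -/
def kelems : List ℕ := List.range (2 ^ (M + 1))

/-- Every element occurs in the enumeration (as `toBits`). [folklore] -/
theorem toBits_mem_kelems (u : GF2 M) : toBits M u ∈ kelems M := List.mem_range.2 (toBits_lt M u)

/-- The enumeration has no duplicates. [folklore] -/
theorem nodup_kelems : (kelems M).Nodup := List.nodup_range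

/-- The enumeration as elements lists every element exactly once. [folklore] -/
theorem kelems_map_elt_perm : ∀ u : GF2 M, u ∈ (kelems M).map (GF2.elt M) := fun u =>
  List.mem_map.2 ⟨toBits M u, toBits_mem_kelems M u, elt_toBits M u⟩

/-! ### Cardinality and Fermat -/

/-- `GF(2^{M+1})` is a finite `𝔽₂`-module (through its power basis). [folklore] -/
instance moduleFiniteGF2 : Module.Finite (ZMod 2) (GF2 M) := Module.Finite.of_basis (GF2.basis M)

/-- `GF(2^{M+1})` is finite. [folklore] -/
instance finiteGF2 : Finite (GF2 M) := Module.finite_of_finite (ZMod 2)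

/-- `GF(2^{M+1})` as a `Fintype`. [folklore] -/
instance fintypeGF2 : Fintype (GF2 M) := Fintype.ofFinite _

/-- **`|GF(2^{M+1})| = 2^{M+1}`.** [cite: Mceliece2002, Ch. 9 §9.1] -/
theorem card_GF2 : Fintype.card (GF2 M) = 2 ^ (M + 1) := by
  classical
  rw [Module.card_eq_pow_finrank (K := ZMod 2) (V := GF2 M), ZMod.card,
    Module.finrank_eq_card_basis (GF2.basis M), Fintype.card_fin]

/-- **Fermat in `GF(2^{M+1})`**: `u^{2^{M+1} - 1} = 1` for `u ≠ 0`. [folklore] -/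
theorem pow_card_sub_one {u : GF2 M} (hu : u ≠ 0) : u ^ (2 ^ (M + 1) - 1) = 1 := by
  rw [← card_GF2]; exact FiniteField.pow_card_sub_one_eq_one u hu

/-! ### The modulus context and the arithmetic bridges -/

/-- **The modulus context of `GF(2^{M+1})`** for the `GF(2)[X]` bricks: bit width `M + 2`,
modulus bitmask `canonIrredBits M` (`2^{M+1} ≤ · < 2^{M+2}`), reduction threshold `2^{M+1}`.
[cite: KnuthTAOCP2, §4.6.3] -/
def kctx : ℕ × ℕ × ℕ := (M + 2, canonIrredBits M, 2 ^ (M + 1))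

/-- `AdjoinRoot.mk` forgets multiples of the modulus: `mk (p mod f) = mk p`. [folklore] -/
theorem mk_modByMonic (p : (ZMod 2)[X]) :
    AdjoinRoot.mk (canonIrred M) (p %ₘ canonIrred M) = AdjoinRoot.mk (canonIrred M) p := by
  rw [← AdjoinRoot.modByMonicHom_mk (monic_canonIrred M) p]
  exact AdjoinRoot.mk_leftInverse (monic_canonIrred M) _

/-- **Addition is `xor`.** [cite: KnuthTAOCP2, §4.6] -/
theorem elt_xor (a b : ℕ) : GF2.elt M (a ^^^ b) = GF2.elt M a + GF2.elt M b := by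
  rw [GF2.elt, GF2.elt, GF2.elt, bitsPoly_xor, map_add]

/-- `xorW` at width `≥ M+1` on reduced bitmasks is addition. [folklore] -/
theorem elt_xorW {W a b : ℕ} (hW : M + 1 ≤ W) (ha : a < 2 ^ (M + 1)) (hb : b < 2 ^ (M + 1)) :
    GF2.elt M (xorW W a b) = GF2.elt M a + GF2.elt M b ∧ xorW W a b < 2 ^ (M + 1) := by
  have ha' : a < 2 ^ W := ha.trans_le (Nat.pow_le_pow_right two_pos hW)
  have hb' : b < 2 ^ W := hb.trans_le (Nat.pow_le_pow_right two_pos hW)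
  rw [xorW_eq_of_lt ha' hb']
  exact ⟨elt_xor M a b, Nat.xor_lt_two_pow ha hb⟩

/-- **Multiplication in `GF(2^{M+1})` on bitmasks** (the `GF(2)[X]` brick `mulMod` in the context
`kctx M`, `M + 1` rounds). [cite: KnuthTAOCP2, §4.6.3] -/
def kmul (a b : ℕ) : ℕ := GF2X.mulMod (M + 2) (canonIrredBits M) (2 ^ (M + 1)) (M + 2) a b

/-- **What `kmul` computes**: the reduced bitmask of the product. [cite: KnuthTAOCP2, §4.6.3] -/
theorem kmul_spec {a b : ℕ} (ha : a < 2 ^ (M + 1)) (hb : b < 2 ^ (M + 1)) :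
    GF2.elt M (kmul M a b) = GF2.elt M a * GF2.elt M b ∧ kmul M a b < 2 ^ (M + 1) := by
  obtain ⟨hf1, hf2, -⟩ := canonIrredBits_spec M
  obtain ⟨hpoly, hlt⟩ := GF2X.mulMod_spec (m := M + 1) (W := M + 2) (n := M + 2) hf1 hf2 le_rfl
    (ha.trans (Nat.pow_lt_pow_right (by norm_num) (by omega))) hb
  refine ⟨?_, hlt⟩
  rw [GF2.elt, kmul, hpoly, show bitsPoly (canonIrredBits M) = canonIrred M from rfl, mk_modByMonic,
    map_mul]
  rfl

/-- `kmul` through the context. [folklore] -/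
theorem kmul_eq_mulMod (a b : ℕ) :
    kmul M a b = GF2X.mulMod (kctx M).1 (kctx M).2.1 (kctx M).2.2 (kctx M).1 a b := rfl

/-- **Powers in `GF(2^{M+1})` on bitmasks** (`powMod`, exponent in unary). [cite: KnuthTAOCP2, §4.6.3] -/
def kpow (a e : ℕ) : ℕ := GF2X.powMod (M + 2) (canonIrredBits M) (2 ^ (M + 1)) (M + 2) a e

/-- **What `kpow` computes.** [cite: KnuthTAOCP2, §4.6.3] -/
theorem kpow_spec {a : ℕ} (ha : a < 2 ^ (M + 1)) (e : ℕ) :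
    GF2.elt M (kpow M a e) = GF2.elt M a ^ e ∧ kpow M a e < 2 ^ (M + 1) := by
  obtain ⟨hf1, hf2, -⟩ := canonIrredBits_spec M
  obtain ⟨hpoly, hlt⟩ := GF2X.powMod_spec (m := M + 1) (W := M + 2) (n := M + 2) (by omega) hf1 hf2 le_rfl
    (ha.trans (Nat.pow_lt_pow_right (by norm_num) (by omega))) e
  refine ⟨?_, hlt⟩
  rw [GF2.elt, kpow, hpoly, show bitsPoly (canonIrredBits M) = canonIrred M from rfl, mk_modByMonic,
    map_pow]
  rfl

/-- One round of right-to-left binary powering in `K` on the state `(acc, p, z')` (context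
`c = (W, f, P)`): `acc ← acc·p` if `z'` odd, `p ← p²`, `z' ← ⌊z'/2⌋`. [cite: KnuthTAOCP2, §4.6.3, Algorithm A] -/
def kpowBStep (c : ℕ × ℕ × ℕ) (st : ℕ × ℕ × ℕ) : ℕ × ℕ × ℕ :=
  (if st.2.2 % 2 = 1 then GF2X.mulMod c.1 c.2.1 c.2.2 c.1 st.1 st.2.1 else st.1,
    GF2X.mulMod c.1 c.2.1 c.2.2 c.1 st.2.1 st.2.1, st.2.2 / 2)

/-- **Power with binary exponent** `z` and unary round budget `B` (correct when `z < 2ᴮ`).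
[cite: KnuthTAOCP2, §4.6.3, Algorithm A] -/
def kpowB (c : ℕ × ℕ × ℕ) (a z B : ℕ) : ℕ :=
  ((List.replicate B ()).foldl (fun st _ => kpowBStep c st) (1, a, z)).1

/-- The loop invariant of `kpowB`: after `j` rounds the state is `(a^{z mod 2ʲ}, a^{2ʲ}, ⌊z/2ʲ⌋)`,
reduced. [cite: KnuthTAOCP2, §4.6.3] -/
theorem foldl_kpowBStep_spec {a : ℕ} (ha : a < 2 ^ (M + 1)) (z j : ℕ) :
    let st := (List.replicate j ()).foldl (fun st _ => kpowBStep (kctx M) st) (1, a, z)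
    st.1 < 2 ^ (M + 1) ∧ st.2.1 < 2 ^ (M + 1) ∧ GF2.elt M st.1 = GF2.elt M a ^ (z % 2 ^ j) ∧
      GF2.elt M st.2.1 = GF2.elt M a ^ (2 ^ j) ∧ st.2.2 = z / 2 ^ j := by
  induction j with
  | zero =>
    show 1 < 2 ^ (M + 1) ∧ a < 2 ^ (M + 1) ∧ GF2.elt M 1 = GF2.elt M a ^ (z % 2 ^ 0) ∧
      GF2.elt M a = GF2.elt M a ^ (2 ^ 0) ∧ z = z / 2 ^ 0
    rw [pow_zero, Nat.mod_one, pow_zero, pow_one, Nat.div_one]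
    exact ⟨Nat.one_lt_two_pow (by omega), ha, by rw [GF2.elt, bitsPoly_one, map_one], rfl, rfl⟩
  | succ j ih =>
    obtain ⟨h1, h2, h3, h4, h5⟩ := ih
    simp only [List.replicate_succ', List.foldl_append, List.foldl_cons, List.foldl_nil]
    set st := (List.replicate j ()).foldl (fun st _ => kpowBStep (kctx M) st) (1, a, z)
    obtain ⟨hsqv, hsq⟩ := kmul_spec M h2 h2
    have hz : z % 2 ^ (j + 1) = z % 2 ^ j + 2 ^ j * (z / 2 ^ j % 2) := by
      rw [pow_succ, Nat.mod_mul]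
    refine ⟨?_, hsq, ?_, by simp only [kpowBStep]; rw [← kmul_eq_mulMod, hsqv, h4, ← pow_add, ← two_mul, ← pow_succ'], by
      simp only [kpowBStep]; rw [h5, Nat.div_div_eq_div_mul, ← pow_succ]⟩
    · simp only [kpowBStep]
      split_ifs
      · rw [← kmul_eq_mulMod]; exact (kmul_spec M h1 h2).2
      · exact h1
    · simp only [kpowBStep]
      rw [hz, pow_add, ← h3, h5]
      split_ifs with hodd
      · rw [← kmul_eq_mulMod, (kmul_spec M h1 h2).1, h4, hodd, mul_one]
      · have h0 : z / 2 ^ j % 2 = 0 := by omega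
        rw [h0, mul_zero, pow_zero, mul_one]

/-- **`kpowB` computes `a ^ z`** when `z < 2ᴮ`, reduced. [cite: KnuthTAOCP2, §4.6.3] -/
theorem kpowB_spec {a : ℕ} (ha : a < 2 ^ (M + 1)) {z B : ℕ} (hz : z < 2 ^ B) :
    GF2.elt M (kpowB (kctx M) a z B) = GF2.elt M a ^ z ∧ kpowB (kctx M) a z B < 2 ^ (M + 1) := by
  obtain ⟨h1, -, h3, -, -⟩ := foldl_kpowBStep_spec M ha z B
  exact ⟨by rw [kpowB, h3, Nat.mod_eq_of_lt hz], h1⟩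

/-- **The Fermat inverse** `a^{q-2}`, `q = 2^{M+1}`, by binary powering (`M + 2` rounds).
[cite: KnuthTAOCP2, §4.6.3 (ex.)] -/
def kinv (a : ℕ) : ℕ := kpowB (kctx M) a (2 ^ (M + 1) - 2) (M + 2)

/-- **What `kinv` computes**: the inverse of a nonzero element (and `0 ↦ 0`-or-junk is not used).
[folklore] -/
theorem kinv_spec {a : ℕ} (ha : a < 2 ^ (M + 1)) (h0 : GF2.elt M a ≠ 0) :
    GF2.elt M (kinv M a) = (GF2.elt M a)⁻¹ ∧ kinv M a < 2 ^ (M + 1) := by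
  have hq : 2 ≤ 2 ^ (M + 1) := by
    calc 2 = 2 ^ 1 := rfl
      _ ≤ 2 ^ (M + 1) := Nat.pow_le_pow_right two_pos (by omega)
  obtain ⟨hpow, hlt⟩ := kpowB_spec M ha (z := 2 ^ (M + 1) - 2) (B := M + 2)
    (by have := Nat.pow_lt_pow_right (a := 2) (by norm_num) (show M + 1 < M + 2 by omega); omega)
  refine ⟨?_, hlt⟩
  rw [kinv, hpow]
  have h1 : GF2.elt M a ^ (2 ^ (M + 1) - 2) * GF2.elt M a = 1 := by
    rw [← pow_succ, show 2 ^ (M + 1) - 2 + 1 = 2 ^ (M + 1) - 1 by omega, pow_card_sub_one M h0]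
  exact eq_inv_of_mul_eq_one_left h1

/-- `kinv` through the context. [folklore] -/
theorem kinv_eq (a : ℕ) : kinv M a = kpowB (kctx M) a ((kctx M).2.2 - 2) (kctx M).1 := rfl

/-! ### `CodeFP` forms on the context code -/

/-- Code of the modulus context `(1ᵂ, f, P)` (as in `GF2XArithFP.lean`). [folklore] -/
abbrev kctxE : ℕ × ℕ × ℕ → List Bool := pairE unE (pairE natE natE)

/-- **`((W, f, P), a, b) ↦ mulMod W f P W a b` on codes** (`W` rounds) — with the context `kctx M`
this is `kmul M a b`. [cite: AroraBarak2009, §1.3] -/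
theorem kmulFP : CodeFP (pairE kctxE (pairE natE natE)) natE
    (fun p => GF2X.mulMod p.1.1 p.1.2.1 p.1.2.2 p.1.1 p.2.1 p.2.2) :=
  (GF2X.mulModFP.comp ((fst _ _).pair ((fst _ _).fst'.pair (snd _ _)))).congr fun _ => rfl

/-- **`((W, f, P), a, 1ᵉ) ↦ powMod W f P W a e` on codes** — with the context `kctx M` this is
`kpow M a e`. [cite: AroraBarak2009, §1.3] -/
theorem kpowFP : CodeFP (pairE kctxE (pairE natE unE)) natE
    (fun p => GF2X.powMod p.1.1 p.1.2.1 p.1.2.2 p.1.1 p.2.1 p.2.2) :=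
  (GF2X.powModFP.comp ((fst _ _).pair ((fst _ _).fst'.pair (snd _ _)))).congr fun _ => rfl

/-- `kpow` through the context. [folklore] -/
theorem kpow_eq_powMod (a e : ℕ) :
    kpow M a e = GF2X.powMod (kctx M).1 (kctx M).2.1 (kctx M).2.2 (kctx M).1 a e := rfl

/-- Sizes along the binary powering loop, on every input: `acc` is `1` or a brick output (`< 2ᵂ`),
`p` is the input or a brick output, the remaining exponent is at most the exponent. [folklore] -/
theorem foldl_kpowBStep_bound (c : ℕ × ℕ × ℕ) (a z : ℕ) : ∀ (l : List Unit) (st : ℕ × ℕ × ℕ),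
    Nat.size st.1 ≤ c.1 + 1 → Nat.size st.2.1 ≤ Nat.size a + c.1 → st.2.2 ≤ z →
    Nat.size (l.foldl (fun st _ => kpowBStep c st) st).1 ≤ c.1 + 1 ∧
      Nat.size (l.foldl (fun st _ => kpowBStep c st) st).2.1 ≤ Nat.size a + c.1 ∧
      (l.foldl (fun st _ => kpowBStep c st) st).2.2 ≤ z
  | [], _, h1, h2, h3 => ⟨h1, h2, h3⟩
  | _ :: l, st, h1, _, h3 => by
    rw [List.foldl_cons]
    refine foldl_kpowBStep_bound c a z l _ ?_ ?_ ((Nat.div_le_self _ _).trans h3)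
    · simp only [kpowBStep]
      split_ifs
      · exact (Nat.size_le.2 (GF2X.mulMod_lt _ _ _ _ _ _)).trans (Nat.le_succ _)
      · exact h1
    · simp only [kpowBStep]
      exact (Nat.size_le.2 (GF2X.mulMod_lt _ _ _ _ _ _)).trans (Nat.le_add_left _ _)

/-- **`((W, f, P), a, z, 1ᴮ) ↦ kpowB (W, f, P) a z B` on codes.** [cite: AroraBarak2009, §1.3; KnuthTAOCP2, §4.6.3] -/
theorem kpowBFP : CodeFP (pairE kctxE (pairE natE (pairE natE unE))) natE
    (fun p => kpowB p.1 p.2.1 p.2.2.1 p.2.2.2) := by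
  -- context `σ = ((W, f, P), a, z)`, state `(acc, p, z')`
  let σE : (ℕ × ℕ × ℕ) × ℕ × ℕ → List Bool := pairE kctxE (pairE natE natE)
  let stE : ℕ × ℕ × ℕ → List Bool := pairE natE (pairE natE natE)
  have hstep : CodeFP (pairE σE (pairE unitE stE)) stE (fun t => kpowBStep t.1.1 t.2.2) := by
    have hc : CodeFP (pairE σE (pairE unitE stE)) kctxE (fun t => t.1.1) := (fst _ _).fst'
    have hacc : CodeFP (pairE σE (pairE unitE stE)) natE (fun t => t.2.2.1) := (snd _ _).snd'.fst'
    have hp : CodeFP (pairE σE (pairE unitE stE)) natE (fun t => t.2.2.2.1) := (snd _ _).snd'.snd'.fst'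
    have hz : CodeFP (pairE σE (pairE unitE stE)) natE (fun t => t.2.2.2.2) := (snd _ _).snd'.snd'.snd'
    have hodd : CodeFP (pairE σE (pairE unitE stE)) bitE (fun t => decide (t.2.2.2.2 % 2 = 1)) :=
      natEq.comp ((natMod.comp (hz.pair (const _ 2))).pair (const _ 1))
    have hmul : ∀ {g h : ((ℕ × ℕ × ℕ) × ℕ × ℕ) × Unit × ℕ × ℕ × ℕ → ℕ},
        CodeFP (pairE σE (pairE unitE stE)) natE g → CodeFP (pairE σE (pairE unitE stE)) natE h →
        CodeFP (pairE σE (pairE unitE stE)) natE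
          (fun t => GF2X.mulMod t.1.1.1 t.1.1.2.1 t.1.1.2.2 t.1.1.1 (g t) (h t)) :=
      fun hg hh => (kmulFP.comp (hc.pair (hg.pair hh)) :)
    have h1 : CodeFP (pairE σE (pairE unitE stE)) natE
        (fun t => if t.2.2.2.2 % 2 = 1 then GF2X.mulMod t.1.1.1 t.1.1.2.1 t.1.1.2.2 t.1.1.1 t.2.2.1 t.2.2.2.1 else t.2.2.1) :=
      (hodd.ite (hmul hacc hp) hacc).congr fun t => by simp only [decide_eq_true_eq]
    exact (h1.pair ((hmul hp hp).pair (natDiv.comp (hz.pair (const _ 2))))).congr fun _ => rfl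
  have hinit : CodeFP σE stE (fun s => ((1 : ℕ), s.2.1, s.2.2)) := ((const _ 1).pair (snd _ _) :)
  have h := foldl (eσ := σE) (eα := unitE) (eβ := stE)
    (step := fun (s : (ℕ × ℕ × ℕ) × ℕ × ℕ) (_ : Unit) (st : ℕ × ℕ × ℕ) => kpowBStep s.1 st)
    (init := fun s => (1, s.2.1, s.2.2)) hstep hinit (7 * X + 6)
    (fun s l₁ l₂ => by
      obtain ⟨⟨W, f, P⟩, a, z⟩ := s
      obtain ⟨h1, h2, h3⟩ := foldl_kpowBStep_bound (W, f, P) a z l₁ (1, a, z)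
        (by simp) (Nat.le_add_right _ _) le_rfl
      dsimp only
      set st := l₁.foldl (fun st _ => kpowBStep (W, f, P) st) (1, a, z)
      have h3' : Nat.size st.2.2 ≤ Nat.size z := Nat.size_le_size h3
      simp only [σE, stE, pairE_apply, length_boolPair, eval_add, eval_mul, eval_X, eval_ofNat, length_natE, length_unE]
      simp only [] at h1 h2
      omega)
  exact (h.fst'.comp ((((fst _ _).pair ((snd _ _).fst'.pair (snd _ _).snd'.fst'))).pair
    (replicateUnit.comp (snd _ _).snd'.snd'))).congr fun _ => rfl

/-- **The inverse on codes**: `((W, f, P), a) ↦ kpowB (W, f, P) a (P - 2) W` — with the context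
`kctx M` this is `kinv M a` (`kinv_eq`). [cite: AroraBarak2009, §1.3] -/
theorem kinvFP : CodeFP (pairE kctxE natE) natE (fun p => kpowB p.1 p.2 (p.1.2.2 - 2) p.1.1) :=
  (kpowBFP.comp ((fst _ _).pair ((snd _ _).pair ((natSub.comp ((fst _ _).snd'.snd'.pair (const _ 2))).pair
    (fst _ _).fst'))) :)

end UmansFP

end Literature.Computability.Complexity

end
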